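import Literature.Algebra.Lie.ChevalleyEilenbergFunctoriality
import Literature.Algebra.Lie.ChevalleyEilenbergScalars
import Literature.Algebra.Lie.ChevalleyEilenbergLowDegree
import Literature.NumberTheory.Automorphic.GKModules
import HarnessLib

/-!
# `(𝔤, K)`-cohomology of a `(𝔤, K)`-module of a linear real group

Topic `NumberTheory/Automorphic`; namespace `Literature.NumberTheory.Automorphic`.  Definitions
with bodies and theorems only (no named fact, no `sorry`).  Bridge between the tree's
`(𝔤, K)`-modules of a linear real group (`GKModules`: `G : RealMatrixGroup A N`,
`K = G.maximalCompact`, `𝔤 = G.lie` a REAL Lie algebra, `𝔨 = G.compactLie`, a `K`-action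
`ρK : Representation ℂ K V` and a Lie algebra action `ρ𝔤 : 𝔤 →ₗ⁅ℝ⁆ End_ℂ V` with
`ρK k ∘ ρ𝔤 X ∘ ρK k⁻¹ = ρ𝔤 (Ad k X)`, `IsGKModule.ad_compat`) and the relative Lie algebra
cohomology of `Literature/Algebra/Lie/ChevalleyEilenberg{Complex,Functoriality}`:

* `GKCarrier G ρ𝔤` — `V` as a `𝔤`-module through `ρ𝔤` (type synonym carrying
  `LieRingModule G.lie`, `LieModule ℝ G.lie`; `⁅X, v⁆ = ρ𝔤 X v`, `bracket_def`);
* `RealMatrixGroup.Ad_one`, `Ad_mul` — `Ad` is multiplicative; `RealMatrixGroup.kInLie` — `𝔨` as a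
  Lie subalgebra of `𝔤`;
* `gkPairAction G ρK ρ𝔤 had` — the compatible pair action of `K` on `(𝔤, V)` by `Ad` and `ρK`
  (compatibility = `ad_compat`);
* `gkComplex G ρK ρ𝔤 had` — **the `(𝔤, K)`-complex** `C^•(𝔤, K; V)`: cochains of `𝔤` with values
  in `V`, relative for `𝔨` (`i_X f = θ_X f = 0`, `X ∈ 𝔨`) and fixed by `K`
  (`Ad ⊗ ρK`) [cite: BorelWallach2000, I §5.1 (1)–(3)]; `mem_gkComplex_succ_iff`;
* `GKCarrier.instLieSMulComm`, `gkPairAction_smulComm`, `gkComplex_smulStable`,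
  `gkCohomology.instModuleComplex`, `gkCohomology.instIsScalarTower` — `H^q(𝔤, K; V)` is a
  complex vector space (`c • [z] = [c • z]`);
* `GKCarrier.endo`, `gkCohomologyMap G ρK ρ𝔤 had T hT𝔤 hTK q` — the `ℂ`-linear endomorphism of
  `H^q(𝔤, K; V)` induced by a `ℂ`-linear `T : V → V` commuting with `ρ𝔤` and `ρK` (Hecke-type
  operators), `gkCohomologyMap_apply`;
* `gkInvariants`, `gkCohomologyZeroEquiv : H⁰(𝔤, K; V) ≃ₗ[ℂ] V^{𝔤, K}` — degree `0` is the space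
  of `(𝔤, K)`-invariants [cite: BorelWallach2000, I §1.2 (3)];
* `gkCohomology G ρK ρ𝔤 had q` — **`H^q(𝔤, K; V)`** [cite: BorelWallach2000, I §5.1 (4)], the
  cohomology in which Matsushima–Borel–Wallach (`H^•(Γ\G/K, Ẽ) = H^•(𝔤, K; C^∞(Γ\G) ⊗ E)`,
  [cite: BorelWallach2000, VII]) and the Eichler–Shimura–Harder dictionary of the tree's named
  facts `bianchi_interiorEigenclass_isCuspidal`, `GLnCohomology.cuspidalEigenclass_exists`,
  `GLnCohomology.interiorEigenclass_isCuspidal` are phrased.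

## Design notes

* REAL Lie algebra, COMPLEX coefficients: `𝔤` is a real Lie algebra acting by `ℂ`-linear maps,
  so the complex is the `ℝ`-linear Chevalley–Eilenberg complex `C^q = Hom_ℝ(Λ^q_ℝ 𝔤, V)`
  (`= Hom_ℂ(Λ^q 𝔤_ℂ, V)`), exactly [cite: BorelWallach2000, I §5.1 (1)] with `F = ℝ`; the
  `ℂ`-structure of `H^q(𝔤, K; V)` is the one induced by `V` (postcomposition with complex scalars
  commutes with `d`, `i_x`, `θ_x` and the `K`-action): `gkCohomology.instModuleComplex`,
  `gkCohomology.instIsScalarTower` (via `ChevalleyEilenbergScalars`).  The complexified `𝔤_ℂ`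
  is not introduced.
* Only the axiom `ad_compat` of `IsGKModule` is used (as the hypothesis `had`), so no
  `[StarModule ℝ A] [ContinuousStar A]` context is needed for the pair action; `𝔨` needs
  `[StarModule ℝ A]`.
* NOT here: `H^•(𝔤, K; V) = H^•(𝔤, 𝔨; V)` for connected `K` (needs the derivative axiom
  `hasWeakDeriv` and the exponential), admissibility/finite-dimensionality, Wigner's lemma,
  Poincaré duality, the Matsushima/van Est comparison with de Rham cohomology.

## References

* A. Borel, N. Wallach, *Continuous cohomology, discrete subgroups, and representations of
  reductive groups*, 2nd ed. (2000), I §5.1 (1)–(4); VII §2 (held) [BorelWallach2000].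
* N. Wallach, *Real reductive groups I* (1988), §3.3.1 (`(𝔤, K)`-modules), as in `GKModules`.
-/

noncomputable section

namespace Literature.NumberTheory.Automorphic

open Literature.Algebra.Lie

-- Mathlib idiom: commutator bracket on associative algebras
attribute [local instance 100] LieRing.ofAssociativeRing

variable {A : Type*} [NormedCommRing A] [NormedAlgebra ℝ A] [NormedAlgebra ℚ A] [CompleteSpace A]
  [StarRing A] {N : Type*} [Fintype N] [DecidableEq N] (G : RealMatrixGroup A N)

namespace RealMatrixGroup

/-- `Ad 1 = id`. [folklore] -/
theorem Ad_one : G.Ad 1 = LieHom.id := by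
  ext X : 2
  simp

/-- `Ad (g h) = Ad g ∘ Ad h` (Knapp, I.§10, (1.83)). [folklore] -/
theorem Ad_mul (g h : G.carrier) : G.Ad (g * h) = (G.Ad g).comp (G.Ad h) := by
  ext X : 2
  simp [mul_assoc]

variable [StarModule ℝ A]

/-- The Lie algebra `𝔨` of `K` as a Lie subalgebra of `𝔤` (the range of `𝔨 ↪ 𝔤`). [folklore] -/
def kInLie : LieSubalgebra ℝ G.lie := (LieSubalgebra.inclusion G.compactLie_le_lie).range

/-- Membership in `𝔨 ≤ 𝔤`. [folklore] -/
theorem mem_kInLie_iff (X : G.lie) : X ∈ G.kInLie ↔ (X : Matrix N N A) ∈ G.compactLie := by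
  constructor
  · rintro ⟨Y, rfl⟩
    exact Y.2
  · intro h
    exact ⟨⟨X, h⟩, rfl⟩

end RealMatrixGroup

section GKCohomology

variable {V : Type*} [AddCommGroup V] [Module ℂ V]
  (ρK : Representation ℂ G.maximalCompact V) (ρ𝔤 : G.lie →ₗ⁅ℝ⁆ Module.End ℂ V)

/-- Type synonym: `V` viewed as a `𝔤`-module through `ρ𝔤` (`⁅X, v⁆ = ρ𝔤 X v`).
[cite: BorelWallach2000, I §1.1] -/
@[nolint unusedArguments]
def GKCarrier (_ρ𝔤 : G.lie →ₗ⁅ℝ⁆ Module.End ℂ V) : Type _ := V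

namespace GKCarrier

/-- Additive structure of `V`. [folklore] -/
instance : AddCommGroup (GKCarrier G ρ𝔤) := inferInstanceAs (AddCommGroup V)

/-- Complex structure of `V`. [folklore] -/
instance : Module ℂ (GKCarrier G ρ𝔤) := inferInstanceAs (Module ℂ V)

/-- Real structure of `V` (restriction of scalars). [folklore] -/
instance : Module ℝ (GKCarrier G ρ𝔤) := inferInstanceAs (Module ℝ V)

/-- The identification `V ≃ GKCarrier` (identity). [folklore] -/
def of : V ≃ₗ[ℂ] GKCarrier G ρ𝔤 := LinearEquiv.refl ℂ V

/-- `𝔤` acts on `V` through `ρ𝔤`: `⁅X, v⁆ = ρ𝔤 X v` (a Lie ring module since `ρ𝔤` is a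
morphism of Lie algebras into `End V` with the commutator bracket).
[cite: BorelWallach2000, I §1.1] -/
instance : LieRingModule G.lie (GKCarrier G ρ𝔤) where
  bracket X v := ρ𝔤 X (v : V)
  add_lie X Y v := LinearMap.congr_fun (map_add ρ𝔤 X Y) (v : V)
  lie_add X v w := (ρ𝔤 X).map_add (v : V) (w : V)
  leibniz_lie X Y v := by
    have h := LinearMap.congr_fun (LieHom.map_lie ρ𝔤 X Y) (v : V)
    change ρ𝔤 X (ρ𝔤 Y (v : V)) = ρ𝔤 ⁅X, Y⁆ (v : V) + ρ𝔤 Y (ρ𝔤 X (v : V))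
    rw [h, Ring.lie_def, LinearMap.sub_apply, Module.End.mul_apply, Module.End.mul_apply,
      sub_add_cancel]

/-- `⁅X, v⁆ = ρ𝔤 X v` (definitional). [folklore] -/
theorem bracket_def (X : G.lie) (v : GKCarrier G ρ𝔤) : ⁅X, v⁆ = ρ𝔤 X v := rfl

/-- The action is `ℝ`-bilinear. [folklore] -/
instance : LieModule ℝ G.lie (GKCarrier G ρ𝔤) where
  smul_lie t X v := by
    change ρ𝔤 (t • X) (v : V) = t • ρ𝔤 X (v : V)
    rw [map_smul]
    rfl
  lie_smul t X v := (ρ𝔤 X).map_smul_of_tower t (v : V)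

end GKCarrier

/-- **The pair action of `K` on `(𝔤, V)`**: `Ad` on `𝔤` and `ρK` on `V`; compatible by the
`(𝔤, K)`-module axiom `ρK k ∘ ρ𝔤 X ∘ ρK k⁻¹ = ρ𝔤 (Ad k X)` (`IsGKModule.ad_compat`).
[cite: BorelWallach2000, I §5.1 (1)] -/
def gkPairAction
    (had : ∀ (k : G.maximalCompact) (X : G.lie),
      ρK k ∘ₗ ρ𝔤 X ∘ₗ ρK k⁻¹ = ρ𝔤 (G.Ad (Subgroup.inclusion G.maximalCompact_le_carrier k) X)) :
    ChevalleyEilenberg.PairAction ℝ G.lie (GKCarrier G ρ𝔤) G.maximalCompact where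
  σ k := G.Ad (Subgroup.inclusion G.maximalCompact_le_carrier k)
  τ k := (ρK k).restrictScalars ℝ
  σ_one := by rw [map_one]; exact G.Ad_one
  σ_mul g h := by rw [map_mul]; exact G.Ad_mul _ _
  τ_one := by
    ext v
    change ρK 1 v = v
    rw [map_one]
    rfl
  τ_mul g h := by
    ext v
    change ρK (g * h) v = ρK g (ρK h v)
    rw [map_mul]
    rfl
  compat k X v := by
    change ρK k (ρ𝔤 X (v : V)) = ρ𝔤 (G.Ad _ X) (ρK k (v : V))
    rw [← had k X]
    simp only [LinearMap.coe_comp, Function.comp_apply]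
    congr 2
    rw [← Module.End.mul_apply (f := ρK k⁻¹), ← map_mul, inv_mul_cancel, map_one]
    rfl

variable [StarModule ℝ A]

/-- **The `(𝔤, K)`-complex `C^•(𝔤, K; V)`** of the pair `(ρK, ρ𝔤)`: cochains of the real Lie
algebra `𝔤 = G.lie` with values in `V` (a `𝔤`-module through `ρ𝔤`), relative for
`𝔨 = Lie K` and fixed under `K` acting by `Ad ⊗ ρK`. [cite: BorelWallach2000, I §5.1 (1)–(3)] -/
def gkComplex
    (had : ∀ (k : G.maximalCompact) (X : G.lie),
      ρK k ∘ₗ ρ𝔤 X ∘ₗ ρK k⁻¹ = ρ𝔤 (G.Ad (Subgroup.inclusion G.maximalCompact_le_carrier k) X)) :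
    ChevalleyEilenberg.Subcomplex ℝ G.lie (GKCarrier G ρ𝔤) :=
  ChevalleyEilenberg.Subcomplex.gK ℝ G.lie (GKCarrier G ρ𝔤) G.kInLie (gkPairAction G ρK ρ𝔤 had)

/-- **`(𝔤, K)`-cohomology `H^q(𝔤, K; V)`** of the pair `(ρK, ρ𝔤)` (a real vector space).
[cite: BorelWallach2000, I §5.1 (4)] -/
abbrev gkCohomology
    (had : ∀ (k : G.maximalCompact) (X : G.lie),
      ρK k ∘ₗ ρ𝔤 X ∘ₗ ρK k⁻¹ = ρ𝔤 (G.Ad (Subgroup.inclusion G.maximalCompact_le_carrier k) X))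
    (q : ℕ) : Type _ :=
  (gkComplex G ρK ρ𝔤 had).Cohomology q

/-- Membership in the `(𝔤, K)`-complex, unfolded: for `q ≥ 1`, `f ∈ C^q(𝔤, K; V)` iff
`θ_X f = 0` and `i_X f = 0` for `X ∈ 𝔨` and `k • f = f` for `k ∈ K`.
[cite: BorelWallach2000, I §5.1 (1)–(3)] -/
theorem mem_gkComplex_succ_iff
    (had : ∀ (k : G.maximalCompact) (X : G.lie),
      ρK k ∘ₗ ρ𝔤 X ∘ₗ ρK k⁻¹ = ρ𝔤 (G.Ad (Subgroup.inclusion G.maximalCompact_le_carrier k) X))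
    (q : ℕ) (f : ChevalleyEilenberg.Cochain ℝ G.lie (GKCarrier G ρ𝔤) (q + 1)) :
    f ∈ (gkComplex G ρK ρ𝔤 had).carrier (q + 1) ↔
      (∀ X ∈ G.kInLie, ChevalleyEilenberg.lieDer ℝ G.lie (GKCarrier G ρ𝔤) (q + 1) X f = 0 ∧
          ChevalleyEilenberg.ins q X f = 0) ∧
        ∀ k : G.maximalCompact, (gkPairAction G ρK ρ𝔤 had).act k (q + 1) f = f := by
  unfold gkComplex
  rw [ChevalleyEilenberg.Subcomplex.mem_gK_iff, ChevalleyEilenberg.Subcomplex.mem_rel_succ_iff]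

/-! ### The complex structure on `H^q(𝔤, K; V)` -/

/-- `𝔤` acts on `V` by `ℂ`-linear maps: the complex scalars commute with the bracket.
[folklore] -/
instance GKCarrier.instLieSMulComm :
    ChevalleyEilenberg.LieSMulComm ℂ G.lie (GKCarrier G ρ𝔤) :=
  ⟨fun c X v => (ρ𝔤 X).map_smul c (v : V)⟩

/-- `K` acts on `V` by `ℂ`-linear maps. [folklore] -/
instance gkPairAction_smulComm
    (had : ∀ (k : G.maximalCompact) (X : G.lie),
      ρK k ∘ₗ ρ𝔤 X ∘ₗ ρK k⁻¹ = ρ𝔤 (G.Ad (Subgroup.inclusion G.maximalCompact_le_carrier k) X)) :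
    (gkPairAction G ρK ρ𝔤 had).SMulComm ℂ :=
  ⟨fun k c v => (ρK k).map_smul c (v : V)⟩

/-- The `(𝔤, K)`-complex is stable under the complex scalars.
[cite: BorelWallach2000, I §5.1 (1)] -/
instance gkComplex_smulStable
    (had : ∀ (k : G.maximalCompact) (X : G.lie),
      ρK k ∘ₗ ρ𝔤 X ∘ₗ ρK k⁻¹ = ρ𝔤 (G.Ad (Subgroup.inclusion G.maximalCompact_le_carrier k) X)) :
    (gkComplex G ρK ρ𝔤 had).SMulStable ℂ := by
  unfold gkComplex
  infer_instance

/-- **`H^q(𝔤, K; V)` is a complex vector space** (the structure induced by `V`: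
`c • [z] = [c • z]`).
[cite: BorelWallach2000, I §5.1 (1), (4)] -/
instance gkCohomology.instModuleComplex
    (had : ∀ (k : G.maximalCompact) (X : G.lie),
      ρK k ∘ₗ ρ𝔤 X ∘ₗ ρK k⁻¹ = ρ𝔤 (G.Ad (Subgroup.inclusion G.maximalCompact_le_carrier k) X))
    (q : ℕ) : Module ℂ (gkCohomology G ρK ρ𝔤 had q) :=
  ChevalleyEilenberg.Subcomplex.cohomologyModule (A := ℂ) (gkComplex G ρK ρ𝔤 had) q

/-- The real structure of `H^q(𝔤, K; V)` is the restriction of the complex one. [folklore] -/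
instance gkCohomology.instIsScalarTower
    (had : ∀ (k : G.maximalCompact) (X : G.lie),
      ρK k ∘ₗ ρ𝔤 X ∘ₗ ρK k⁻¹ = ρ𝔤 (G.Ad (Subgroup.inclusion G.maximalCompact_le_carrier k) X))
    (q : ℕ) : IsScalarTower ℝ ℂ (gkCohomology G ρK ρ𝔤 had q) :=
  ChevalleyEilenberg.Subcomplex.cohomology_isScalarTower (A := ℂ) (gkComplex G ρK ρ𝔤 had) q

/-! ### Equivariant endomorphisms act on `H^q(𝔤, K; V)` -/


/-- A `ℂ`-linear endomorphism commuting with `ρ𝔤` is an endomorphism of the `𝔤`-module `V`.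
[folklore] -/
def GKCarrier.endo (T : V →ₗ[ℂ] V) (hT𝔤 : ∀ X : G.lie, T ∘ₗ ρ𝔤 X = ρ𝔤 X ∘ₗ T) :
    GKCarrier G ρ𝔤 →ₗ⁅ℝ,G.lie⁆ GKCarrier G ρ𝔤 where
  toFun v := (T (v : V) : V)
  map_add' v w := T.map_add (v : V) (w : V)
  map_smul' t v := T.map_smul_of_tower t (v : V)
  map_lie' {X v} := LinearMap.congr_fun (hT𝔤 X) (v : V)

omit [StarModule ℝ A] in
/-- Unfolding. [folklore] -/
@[simp] theorem GKCarrier.endo_apply (T : V →ₗ[ℂ] V) (hT𝔤 : ∀ X : G.lie, T ∘ₗ ρ𝔤 X = ρ𝔤 X ∘ₗ T)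
    (v : GKCarrier G ρ𝔤) : GKCarrier.endo G ρ𝔤 T hT𝔤 v = T v := rfl


omit [StarModule ℝ A] in
/-- `T` commutes with the `K`-action on `GKCarrier` (hypothesis repackaged). [folklore] -/
theorem GKCarrier.endo_comm
    (had : ∀ (k : G.maximalCompact) (X : G.lie),
      ρK k ∘ₗ ρ𝔤 X ∘ₗ ρK k⁻¹ = ρ𝔤 (G.Ad (Subgroup.inclusion G.maximalCompact_le_carrier k) X))
    (T : V →ₗ[ℂ] V) (hT𝔤 : ∀ X : G.lie, T ∘ₗ ρ𝔤 X = ρ𝔤 X ∘ₗ T)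
    (hTK : ∀ k : G.maximalCompact, T ∘ₗ ρK k = ρK k ∘ₗ T) (k : G.maximalCompact) :
    ((gkPairAction G ρK ρ𝔤 had).τ k).comp
        (GKCarrier.endo G ρ𝔤 T hT𝔤 : GKCarrier G ρ𝔤 →ₗ[ℝ] GKCarrier G ρ𝔤) =
      (GKCarrier.endo G ρ𝔤 T hT𝔤 : GKCarrier G ρ𝔤 →ₗ[ℝ] GKCarrier G ρ𝔤).comp
        ((gkPairAction G ρK ρ𝔤 had).τ k) := by
  ext v
  exact (LinearMap.congr_fun (hTK k) (v : V)).symm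

/-- The (real-linear) endomorphism of `H^q(𝔤, K; V)` induced by `T`.
[cite: BorelWallach2000, I §5.1] -/
def gkCohomologyMapℝ
    (had : ∀ (k : G.maximalCompact) (X : G.lie),
      ρK k ∘ₗ ρ𝔤 X ∘ₗ ρK k⁻¹ = ρ𝔤 (G.Ad (Subgroup.inclusion G.maximalCompact_le_carrier k) X))
    (T : V →ₗ[ℂ] V) (hT𝔤 : ∀ X : G.lie, T ∘ₗ ρ𝔤 X = ρ𝔤 X ∘ₗ T)
    (hTK : ∀ k : G.maximalCompact, T ∘ₗ ρK k = ρK k ∘ₗ T) (q : ℕ) :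
    gkCohomology G ρK ρ𝔤 had q →ₗ[ℝ] gkCohomology G ρK ρ𝔤 had q :=
  ChevalleyEilenberg.gKCohomologyMap G.kInLie (gkPairAction G ρK ρ𝔤 had)
    (GKCarrier.endo G ρ𝔤 T hT𝔤) (GKCarrier.endo_comm G ρK ρ𝔤 had T hT𝔤 hTK) q

/-- The induced endomorphism commutes with the complex scalars. [folklore] -/
theorem gkCohomologyMapℝ_smul
    (had : ∀ (k : G.maximalCompact) (X : G.lie),
      ρK k ∘ₗ ρ𝔤 X ∘ₗ ρK k⁻¹ = ρ𝔤 (G.Ad (Subgroup.inclusion G.maximalCompact_le_carrier k) X))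
    (T : V →ₗ[ℂ] V) (hT𝔤 : ∀ X : G.lie, T ∘ₗ ρ𝔤 X = ρ𝔤 X ∘ₗ T)
    (hTK : ∀ k : G.maximalCompact, T ∘ₗ ρK k = ρK k ∘ₗ T) (q : ℕ) (c : ℂ)
    (x : gkCohomology G ρK ρ𝔤 had q) :
    gkCohomologyMapℝ G ρK ρ𝔤 had T hT𝔤 hTK q (c • x) =
      c • gkCohomologyMapℝ G ρK ρ𝔤 had T hT𝔤 hTK q x :=
  (ChevalleyEilenberg.Subcomplex.isCochainMapTo_gK_map G.kInLie (gkPairAction G ρK ρ𝔤 had)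
    (GKCarrier.endo G ρ𝔤 T hT𝔤) (GKCarrier.endo_comm G ρK ρ𝔤 had T hT𝔤 hTK)).cohomologyMap_smul _
    (fun _ c f => AlternatingMap.ext fun v => T.map_smul c (f v)) q c x

/-- **The `ℂ`-linear endomorphism of `H^q(𝔤, K; V)` induced by a `ℂ`-linear endomorphism `T`
of `V` commuting with `ρ𝔤` and `ρK`** (e.g. a Hecke operator). [cite: BorelWallach2000, I §5.1] -/
def gkCohomologyMap
    (had : ∀ (k : G.maximalCompact) (X : G.lie),
      ρK k ∘ₗ ρ𝔤 X ∘ₗ ρK k⁻¹ = ρ𝔤 (G.Ad (Subgroup.inclusion G.maximalCompact_le_carrier k) X))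
    (T : V →ₗ[ℂ] V) (hT𝔤 : ∀ X : G.lie, T ∘ₗ ρ𝔤 X = ρ𝔤 X ∘ₗ T)
    (hTK : ∀ k : G.maximalCompact, T ∘ₗ ρK k = ρK k ∘ₗ T) (q : ℕ) :
    gkCohomology G ρK ρ𝔤 had q →ₗ[ℂ] gkCohomology G ρK ρ𝔤 had q where
  toFun := gkCohomologyMapℝ G ρK ρ𝔤 had T hT𝔤 hTK q
  map_add' := map_add _
  map_smul' c x := gkCohomologyMapℝ_smul G ρK ρ𝔤 had T hT𝔤 hTK q c x

/-- Unfolding to the generic induced map. [folklore] -/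
theorem gkCohomologyMap_apply
    (had : ∀ (k : G.maximalCompact) (X : G.lie),
      ρK k ∘ₗ ρ𝔤 X ∘ₗ ρK k⁻¹ = ρ𝔤 (G.Ad (Subgroup.inclusion G.maximalCompact_le_carrier k) X))
    (T : V →ₗ[ℂ] V) (hT𝔤 : ∀ X : G.lie, T ∘ₗ ρ𝔤 X = ρ𝔤 X ∘ₗ T)
    (hTK : ∀ k : G.maximalCompact, T ∘ₗ ρK k = ρK k ∘ₗ T) (q : ℕ)
    (x : gkCohomology G ρK ρ𝔤 had q) :
    gkCohomologyMap G ρK ρ𝔤 had T hT𝔤 hTK q x =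
      (ChevalleyEilenberg.Subcomplex.isCochainMapTo_gK_map G.kInLie (gkPairAction G ρK ρ𝔤 had)
        (GKCarrier.endo G ρ𝔤 T hT𝔤) (GKCarrier.endo_comm G ρK ρ𝔤 had T hT𝔤 hTK)).cohomologyMap
        q x := rfl


/-! ### Degree zero: `H⁰(𝔤, K; V) = V^{𝔤, K}` -/

/-- The `(𝔤, K)`-invariants `V^{𝔤, K} = {v | ρ𝔤 X v = 0, ρK k v = v}`.
[cite: BorelWallach2000, I §1.2 (3)] -/
def gkInvariants : Submodule ℂ V where
  carrier := {v | (∀ X : G.lie, ρ𝔤 X v = 0) ∧ ∀ k : G.maximalCompact, ρK k v = v}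
  add_mem' {a b} ha hb := ⟨fun X => by rw [map_add, ha.1, hb.1, add_zero],
    fun k => by rw [map_add, ha.2, hb.2]⟩
  zero_mem' := ⟨fun X => map_zero _, fun k => map_zero _⟩
  smul_mem' c v hv := ⟨fun X => by rw [map_smul, hv.1, smul_zero], fun k => by rw [map_smul, hv.2]⟩

omit [StarModule ℝ A] in
/-- Membership in `V^{𝔤, K}`. [folklore] -/
theorem mem_gkInvariants_iff (v : V) :
    v ∈ gkInvariants G ρK ρ𝔤 ↔ (∀ X : G.lie, ρ𝔤 X v = 0) ∧ ∀ k : G.maximalCompact, ρK k v = v :=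
  Iff.rfl


/-- The invariants of the `(𝔤, K)`-complex in degree `0` are the `(𝔤, K)`-invariants. [folklore] -/
theorem mem_invariants_gkComplex_iff
    (had : ∀ (k : G.maximalCompact) (X : G.lie),
      ρK k ∘ₗ ρ𝔤 X ∘ₗ ρK k⁻¹ = ρ𝔤 (G.Ad (Subgroup.inclusion G.maximalCompact_le_carrier k) X))
    (v : GKCarrier G ρ𝔤) :
    v ∈ (gkComplex G ρK ρ𝔤 had).invariants ↔
      (∀ X : G.lie, ρ𝔤 X (v : V) = 0) ∧ ∀ k : G.maximalCompact, ρK k (v : V) = v := by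
  rw [ChevalleyEilenberg.Subcomplex.mem_invariants_iff, gkComplex,
    ChevalleyEilenberg.Subcomplex.mem_gK_iff, ChevalleyEilenberg.Subcomplex.mem_rel_zero_iff]
  constructor
  · rintro ⟨⟨-, hK⟩, h𝔤⟩
    refine ⟨fun X => h𝔤 X, fun k => ?_⟩
    exact congrArg (fun f : ChevalleyEilenberg.Cochain ℝ G.lie (GKCarrier G ρ𝔤) 0 => f ![]) (hK k)
  · rintro ⟨h𝔤, hK⟩
    refine ⟨⟨fun X _ => ?_, fun k => ?_⟩, fun X => h𝔤 X⟩
    · ext v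
      rw [ChevalleyEilenberg.lieDer_zero_apply, ChevalleyEilenberg.const_apply,
        AlternatingMap.zero_apply]
      exact h𝔤 X
    · ext v
      rw [ChevalleyEilenberg.PairAction.act_apply, ChevalleyEilenberg.const_apply,
        ChevalleyEilenberg.const_apply]
      exact hK k

/-- **`H⁰(𝔤, K; V) ≃ₗ[ℂ] V^{𝔤, K}`**: the `(𝔤, K)`-cohomology in degree `0` is the space of
`(𝔤, K)`-invariants. [cite: BorelWallach2000, I §1.2 (3), §5.1 (4)] -/
def gkCohomologyZeroEquiv
    (had : ∀ (k : G.maximalCompact) (X : G.lie),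
      ρK k ∘ₗ ρ𝔤 X ∘ₗ ρK k⁻¹ = ρ𝔤 (G.Ad (Subgroup.inclusion G.maximalCompact_le_carrier k) X)) :
    gkCohomology G ρK ρ𝔤 had 0 ≃ₗ[ℂ] gkInvariants G ρK ρ𝔤 where
  toFun c := ⟨((gkComplex G ρK ρ𝔤 had).cohomologyZeroEquivInvariants c : GKCarrier G ρ𝔤),
    (mem_invariants_gkComplex_iff G ρK ρ𝔤 had _).1
      ((gkComplex G ρK ρ𝔤 had).cohomologyZeroEquivInvariants c).2⟩
  map_add' c c' := by
    ext1
    simp only [map_add, Submodule.coe_add]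
    rfl
  map_smul' a c := by
    ext1
    simp only [RingHom.id_apply, Submodule.coe_smul]
    obtain ⟨z, rfl⟩ := (gkComplex G ρK ρ𝔤 had).toCohomology_surjective 0 c
    rw [ChevalleyEilenberg.Subcomplex.smul_toCohomology]
    rfl
  invFun v := (gkComplex G ρK ρ𝔤 had).cohomologyZeroEquivInvariants.symm
    ⟨(v : V), (mem_invariants_gkComplex_iff G ρK ρ𝔤 had _).2 v.2⟩
  left_inv c := by
    simp only [Subtype.coe_eta, LinearEquiv.symm_apply_apply]
  right_inv v := by
    ext1
    simp only [LinearEquiv.apply_symm_apply]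

end GKCohomology

end Literature.NumberTheory.Automorphic
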